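import Literature.NumberTheory.Automorphic.RelNormOneTorus
import Literature.NumberTheory.Automorphic.UnitaryInfinityType
import Literature.NumberTheory.GaloisRepresentations.ArchimedeanHerbrand
import Literature.NumberTheory.GaloisRepresentations.CMTypeHeckeCharacter
import HarnessLib

/-!
# The archimedean torus `U(1)_{L/K}(K ⊗ ℝ)`, its embedding into `U(1)(𝔸_K)`, compactness and weights (CM)

Topic `NumberTheory/Automorphic`; namespace `Literature.NumberTheory.Automorphic`. Continuation of
`RelNormOneTorus` (`relNormOneIdeles K L = U(1)_{L/K}(𝔸_K) = ker N ≤ 𝔸_Lˣ`). Write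
`L_∞ˣ = (InfiniteAdeleRing L)ˣ` with its `Aut(L/K)`-action (the tree's
`ArchHerbrand.mulDistribMulActionUnits`, `ArchimedeanHerbrand`) and `(y, 1) ∈ 𝔸_Lˣ` for the archimedean
idele of `y ∈ L_∞ˣ` (the tree's `GaloisRepresentations.infiniteIdeles L`). CONSTRUCTED and PROVED here,
nothing cited or posited:

* `infIdeleGalNorm K L : L_∞ˣ →* L_∞ˣ`, `N_∞ y = ∏_σ σ • y`, with `(N_∞ y, 1) = N (y, 1)`
  (`infiniteIdeles_infIdeleGalNorm`);
* **`relNormOneInfUnits K L = ker N_∞ ≤ L_∞ˣ`** — the archimedean torus `U(1)_{L/K}(K ⊗_ℚ ℝ)`, closed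
  (`isClosed_relNormOneInfUnits`); for a CM field `L` and `K = L⁺`:
  `{y ∈ L_∞ˣ : y ȳ = 1} = ∏_{w} U(1)` (`mem_relNormOneInfUnits_iff_mul_conj`), one circle per (complex)
  place;
* **`relNormOneInfToIdeles K L : relNormOneInfUnits K L →* relNormOneIdeles K L`**, `y ↦ (y, 1)` — the
  archimedean component `U(1)_∞ ↪ U(1)(𝔸_K)`, injective (`relNormOneInfToIdeles_injective`), continuous;
* CM compactness: `norm_apply_eq_one_of_mem_relNormOneInfUnits` (`y ȳ = 1 ⇒ ‖y_w‖ = 1`, since complex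
  conjugation fixes every infinite place of a CM field — the tree's
  `HeckeCharacter.complexConj_smul_infinitePlace`), `InfiniteAdeleRing.isCompact_setOf_norm_le_one` (the
  polydisc `{‖x_w‖ ≤ 1 ∀ w} ⊆ L_∞` is compact: each `L_w` embeds isometrically in `ℂ`), whence
  **`compactSpace_relNormOneInfUnits_cm : CompactSpace (relNormOneInfUnits L⁺ L)`** (closed, inside the
  polydisc through the closed embedding `Units.embedProduct`). (For a general `L/K` the archimedean torus
  is not compact — e.g. `L/ℚ` real quadratic — so compactness is stated for CM fields only.)
* weights (CM): the place characters `archPlaceChar L w : relNormOneInfUnits L⁺ L →* Circle`,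
  `y ↦ ι_w(y_w)` (the tree's `InfiniteAdeleRing.infLocalUnits L w` is `Circle`-valued on the torus),
  continuous, jointly injective (`archPlaceChars_injective`): `U(1)_∞ ↪ ∏_w U(1)` — the characters in which
  the weights `t ↦ t_w^{±1}` of the archimedean theta test vectors are written (PerL §4.1).

## References

* J. W. S. Cassels, A. Fröhlich (eds.), *Algebraic Number Theory* (1967), Ch. VII (Tate) §1.1 (Galois
  action on archimedean places and completions), Ch. II §16. [CasselsFrohlichANT1967]
* V. Platonov, A. Rapinchuk, *Algebraic Groups and Number Theory* (1994), §6.2 (norm tori; the compact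
  real form `R^{(1)}_{ℂ/ℝ} 𝔾_m = U(1)`). [PlatonovRapinchuk1994]

## Provenance

Reproduced for the tree under the LEAN-IN-TREE rule from the pub-hodgecm cell's package files
`HodgeCM/PerL34/NormOneRelTorusArch.lean` (283 lines) and `HodgeCM/PerL34/NormOneRelTorusWeights.lean`
(102 lines; seat pv11-g4, gate run 25), re-based on the tree (`infUnitsToIdele` ↦
`GaloisRepresentations.infiniteIdeles`, the units action ↦ `ArchHerbrand.mulDistribMulActionUnits`,
`complexConj_smul_infinitePlace` ↦ the tree's, `ι_w` ↦ `InfiniteAdeleRing.infLocalUnits`); the PKG-dictionary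
records `unitaryLineArchTorus` / `unitaryLineTorusDatum_A` are not reproduced. Model-construction cell node W8t (iii).
-/

set_option autoImplicit false

noncomputable section

open _root_.Topology _root_.Set _root_.Function
open NumberField IsDedekindDomain InfinitePlace

namespace Literature.NumberTheory.Automorphic

/-! ## § 1. The archimedean idele `(y, 1)` and the Galois action -/

section Action

variable {K L : Type} [Field K] [Field L] [NumberField L] [Algebra K L]

/-- The archimedean idele `(y, 1)` of `y ∈ L_∞ˣ` (the tree's `infiniteIdeles`, definitional). [folklore] -/
theorem coe_infiniteIdeles_eq (y : (InfiniteAdeleRing L)ˣ) :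
    ((GaloisRepresentations.infiniteIdeles L y : GaloisRepresentations.ideleGroup L) : AdeleRing (𝓞 L) L) =
      ((y : InfiniteAdeleRing L), (1 : FiniteAdeleRing (𝓞 L) L)) := rfl

/-- `y ↦ (y, 1)` is injective. [folklore] -/
theorem infiniteIdeles_injective : Function.Injective (GaloisRepresentations.infiniteIdeles L) := by
  intro a b h
  have h' := congrArg (fun u : GaloisRepresentations.ideleGroup L => ((u : AdeleRing (𝓞 L) L)).1) h
  exact Units.ext h'

/-- `σ • (y, 1) = (σ • y, 1)`. [folklore] -/
theorem galSmul_infiniteIdeles (σ : L ≃ₐ[K] L) (y : (InfiniteAdeleRing L)ˣ) :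
    σ • GaloisRepresentations.infiniteIdeles L y = GaloisRepresentations.infiniteIdeles L (σ • y) := by
  refine Units.ext (Prod.ext rfl ?_)
  show σ • (1 : FiniteAdeleRing (𝓞 L) L) = 1
  exact smul_one σ

omit [NumberField L] in
/-- `y ↦ σ • y` is continuous on `L_∞ˣ` (units topology; the action on `L_∞` is by homeomorphisms).
[folklore] -/
theorem continuous_galSmul_infUnits (σ : L ≃ₐ[K] L) :
    Continuous fun y : (InfiniteAdeleRing L)ˣ => σ • y := by
  refine Units.continuous_iff.mpr ⟨?_, ?_⟩
  · exact (continuous_const_smul σ).comp Units.continuous_val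
  · have h : (fun y : (InfiniteAdeleRing L)ˣ => (((σ • y)⁻¹ : (InfiniteAdeleRing L)ˣ) : InfiniteAdeleRing L)) =
        fun y => σ • (((y⁻¹ : (InfiniteAdeleRing L)ˣ)) : InfiniteAdeleRing L) := by
      funext y; rw [← smul_inv']; rfl
    rw [h]
    exact (continuous_const_smul σ).comp Units.continuous_coe_inv

end Action

/-! ## § 2. The archimedean Galois norm and the torus `U(1)_{L/K}(K ⊗ ℝ)` -/

section ArchTorus

variable (K L : Type) [Field K] [Field L] [Algebra K L] [FiniteDimensional K L]

/-- The Galois norm on `L_∞ˣ`: `N_∞ y = ∏_{σ ∈ Aut(L/K)} σ • y`. [folklore] -/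
def infIdeleGalNorm : (InfiniteAdeleRing L)ˣ →* (InfiniteAdeleRing L)ˣ where
  toFun y := ∏ σ : L ≃ₐ[K] L, σ • y
  map_one' := by simp
  map_mul' y z := by
    rw [← Finset.prod_mul_distrib]
    exact Finset.prod_congr rfl fun σ _ => smul_mul' σ y z

/-- Unfolding `N_∞`. [folklore] -/
theorem infIdeleGalNorm_apply (y : (InfiniteAdeleRing L)ˣ) :
    infIdeleGalNorm K L y = ∏ σ : L ≃ₐ[K] L, σ • y := rfl

/-- `N_∞` is continuous. [folklore] -/
theorem continuous_infIdeleGalNorm : Continuous (infIdeleGalNorm K L) := by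
  change Continuous fun y : (InfiniteAdeleRing L)ˣ => ∏ σ : L ≃ₐ[K] L, σ • y
  exact continuous_finsetProd _ fun σ _ => continuous_galSmul_infUnits σ

/-- **`U(1)_{L/K}(K ⊗ ℝ)`**, the archimedean torus: units of `L_∞` of relative norm one. [folklore] -/
def relNormOneInfUnits : Subgroup (InfiniteAdeleRing L)ˣ := (infIdeleGalNorm K L).ker

/-- Membership: `N_∞ y = 1`. [folklore] -/
theorem mem_relNormOneInfUnits_iff (y : (InfiniteAdeleRing L)ˣ) :
    y ∈ relNormOneInfUnits K L ↔ infIdeleGalNorm K L y = 1 := Iff.rfl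

/-- The archimedean torus is closed in `L_∞ˣ`. [folklore] -/
theorem isClosed_relNormOneInfUnits :
    IsClosed (relNormOneInfUnits K L : Set (InfiniteAdeleRing L)ˣ) := by
  rw [relNormOneInfUnits, MonoidHom.coe_ker]
  exact isClosed_singleton.preimage (continuous_infIdeleGalNorm K L)

variable [NumberField L]

/-- `(N_∞ y, 1) = N (y, 1)`: the archimedean idele map intertwines the two Galois norms. [folklore] -/
theorem infiniteIdeles_infIdeleGalNorm (y : (InfiniteAdeleRing L)ˣ) :
    GaloisRepresentations.infiniteIdeles L (infIdeleGalNorm K L y) =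
      AdeleRing.ideleGalNorm K L (GaloisRepresentations.infiniteIdeles L y) := by
  rw [AdeleRing.ideleGalNorm_apply, infIdeleGalNorm_apply, map_prod]
  exact Finset.prod_congr rfl fun σ _ => (galSmul_infiniteIdeles σ y).symm

/-- `(y, 1) ∈ U(1)(𝔸_K)` for `y` in the archimedean torus. [folklore] -/
theorem infiniteIdeles_mem_relNormOneIdeles {y : (InfiniteAdeleRing L)ˣ}
    (hy : y ∈ relNormOneInfUnits K L) :
    GaloisRepresentations.infiniteIdeles L y ∈ relNormOneIdeles K L := by
  rw [mem_relNormOneIdeles_iff, ← infiniteIdeles_infIdeleGalNorm,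
    (mem_relNormOneInfUnits_iff K L y).mp hy, map_one]

/-- **The archimedean component `U(1)(K ⊗ ℝ) → U(1)(𝔸_K)`**, `y ↦ (y, 1)`. [folklore] -/
def relNormOneInfToIdeles : relNormOneInfUnits K L →* relNormOneIdeles K L :=
  ((GaloisRepresentations.infiniteIdeles L).comp (relNormOneInfUnits K L).subtype).codRestrict
    (relNormOneIdeles K L) fun y => infiniteIdeles_mem_relNormOneIdeles K L y.2

/-- Values of the archimedean component map. [folklore] -/
@[simp] theorem coe_relNormOneInfToIdeles (y : relNormOneInfUnits K L) :
    ((relNormOneInfToIdeles K L y : relNormOneIdeles K L) : GaloisRepresentations.ideleGroup L) =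
      GaloisRepresentations.infiniteIdeles L y := rfl

/-- The archimedean component map is injective. [folklore] -/
theorem relNormOneInfToIdeles_injective : Function.Injective (relNormOneInfToIdeles K L) := by
  intro a b h
  have h' := congrArg (fun u : relNormOneIdeles K L => (u : GaloisRepresentations.ideleGroup L)) h
  simp only [coe_relNormOneInfToIdeles] at h'
  exact Subtype.ext (infiniteIdeles_injective h')

/-- The archimedean component map is continuous. [folklore] -/
theorem continuous_relNormOneInfToIdeles : Continuous (relNormOneInfToIdeles K L) :=
  ((continuous_infiniteIdeles L).comp continuous_subtype_val).subtype_mk _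

/-- The idele norm of an archimedean torus element is one. [folklore] -/
theorem ideleNorm_infiniteIdeles_eq_one (y : relNormOneInfUnits K L) :
    IdeleClassGroup.ideleNorm L (GaloisRepresentations.infiniteIdeles L (y : (InfiniteAdeleRing L)ˣ)) = 1 :=
  mem_normOneIdeles.mp
    (relNormOneIdeles_le_normOneIdeles K L (infiniteIdeles_mem_relNormOneIdeles K L y.2))

end ArchTorus

/-! ## § 3. The CM case: `U(W)(L⁺ ⊗ ℝ) = {y ∈ L_∞ˣ : y ȳ = 1} = ∏_w U(1)` is compact -/

section CM

variable (L : Type) [Field L] [NumberField L] [IsCMField L]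

/-- For a CM field, `N_∞ y = y · ȳ` over `L⁺`. [folklore] -/
theorem infIdeleGalNorm_eq_mul_complexConj_smul (y : (InfiniteAdeleRing L)ˣ) :
    infIdeleGalNorm (maximalRealSubfield L) L y = y * IsCMField.complexConj L • y := by
  classical
  rw [infIdeleGalNorm_apply, univ_algEquiv_maximalRealSubfield_eq_pair,
    Finset.prod_pair (IsCMField.complexConj_ne_one L).symm, one_smul]

/-- For a CM field: `y ∈ U(1)(L⁺ ⊗ ℝ) ↔ y · ȳ = 1` in `L_∞ˣ`. [folklore] -/
theorem mem_relNormOneInfUnits_iff_mul_conj (y : (InfiniteAdeleRing L)ˣ) :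
    y ∈ relNormOneInfUnits (maximalRealSubfield L) L ↔ y * IsCMField.complexConj L • y = 1 := by
  rw [mem_relNormOneInfUnits_iff, infIdeleGalNorm_eq_mul_complexConj_smul]

/-- `‖(c • x)_w‖ = ‖x_w‖`: complex conjugation fixes every infinite place of a CM field (the tree's
`HeckeCharacter.complexConj_smul_infinitePlace`) and acts isometrically on the completions. [folklore] -/
theorem InfiniteAdeleRing.norm_complexConj_smul_apply (x : InfiniteAdeleRing L) (w : InfinitePlace L) :
    ‖(IsCMField.complexConj L • x) w‖ = ‖x w‖ := by
  have h := InfiniteAdeleRing.norm_smul_apply_smul (maximalRealSubfield L) (IsCMField.complexConj L) x w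
  rwa [GaloisRepresentations.HeckeCharacter.complexConj_smul_infinitePlace w] at h

/-- On the archimedean torus of a CM field every component has absolute value one:
`y ȳ = 1 ⇒ ‖y_w‖ = 1`. [folklore] -/
theorem norm_apply_eq_one_of_mem_relNormOneInfUnits {y : (InfiniteAdeleRing L)ˣ}
    (hy : y ∈ relNormOneInfUnits (maximalRealSubfield L) L) (w : InfinitePlace L) :
    ‖(y : InfiniteAdeleRing L) w‖ = 1 := by
  have h1 : (y : InfiniteAdeleRing L) w * (IsCMField.complexConj L • (y : InfiniteAdeleRing L)) w = 1 :=
    congrArg (fun u : (InfiniteAdeleRing L)ˣ => (u : InfiniteAdeleRing L) w)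
      ((mem_relNormOneInfUnits_iff_mul_conj L y).mp hy)
  have h3 : ‖(y : InfiniteAdeleRing L) w‖ * ‖(y : InfiniteAdeleRing L) w‖ = 1 := by
    nth_rw 2 [← InfiniteAdeleRing.norm_complexConj_smul_apply L (y : InfiniteAdeleRing L) w]
    rw [← norm_mul, h1, norm_one]
  rcases mul_self_eq_one_iff.mp h3 with h | h
  · exact h
  · exact absurd h (by have := norm_nonneg ((y : InfiniteAdeleRing L) w); intro h'; linarith)

omit [NumberField L] [IsCMField L] in
/-- The closed polydisc `{x : ‖x_w‖ ≤ 1 ∀ w} ⊆ L_∞` is compact (each `L_w` embeds isometrically and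
closedly in `ℂ`, Mathlib `isometry_extensionEmbedding`). [folklore] -/
theorem InfiniteAdeleRing.isCompact_setOf_norm_le_one :
    IsCompact {x : InfiniteAdeleRing L | ∀ w, ‖x w‖ ≤ 1} := by
  have hball : ∀ w : InfinitePlace L, IsCompact (Metric.closedBall (0 : w.Completion) 1) := fun w => by
    have h := (Completion.isometry_extensionEmbedding w).preimage_closedBall 0 1
    rw [map_zero] at h
    rw [← h]
    exact (Completion.isometry_extensionEmbedding w).isClosedEmbedding.isCompact_preimage
      (isCompact_closedBall _ _)
  have hset : {x : InfiniteAdeleRing L | ∀ w, ‖x w‖ ≤ 1} =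
      Set.univ.pi fun w : InfinitePlace L => Metric.closedBall (0 : w.Completion) 1 := by
    ext x
    refine ⟨fun h w _ => ?_, fun h w => ?_⟩
    · rw [Metric.mem_closedBall, dist_zero_right]; exact h w
    · have h' := h w (Set.mem_univ w); rwa [Metric.mem_closedBall, dist_zero_right] at h'
  rw [hset]
  exact isCompact_univ_pi hball

/-- **`U(W)(L⁺ ⊗ ℝ)` is compact** for a hermitian line `W` over a CM extension: the archimedean torus is
a closed subgroup of `L_∞ˣ` inside `{‖y_w‖ = 1 ∀ w} = ∏_w U(1)` (closed embedding
`Units.embedProduct`). [cite: PlatonovRapinchuk1994, §6.2] -/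
theorem isCompact_relNormOneInfUnits_cm :
    IsCompact (relNormOneInfUnits (maximalRealSubfield L) L : Set (InfiniteAdeleRing L)ˣ) := by
  have hC := InfiniteAdeleRing.isCompact_setOf_norm_le_one L
  have hemb := Units.isClosedEmbedding_embedProduct (α := InfiniteAdeleRing L)
  rw [hemb.isInducing.isCompact_iff]
  refine (hC.prod (hC.image MulOpposite.continuous_op)).of_isClosed_subset
    (hemb.isClosedMap _ (isClosed_relNormOneInfUnits (maximalRealSubfield L) L)) ?_
  rintro _ ⟨y, hy, rfl⟩
  refine ⟨fun w => (norm_apply_eq_one_of_mem_relNormOneInfUnits L hy w).le, ?_⟩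
  exact ⟨((y⁻¹ : (InfiniteAdeleRing L)ˣ) : InfiniteAdeleRing L),
    fun w => (norm_apply_eq_one_of_mem_relNormOneInfUnits L (inv_mem hy) w).le, rfl⟩

/-- `U(W)(L⁺ ⊗ ℝ)` is a compact abelian topological group. [cite: PlatonovRapinchuk1994, §6.2] -/
instance compactSpace_relNormOneInfUnits_cm :
    CompactSpace (relNormOneInfUnits (maximalRealSubfield L) L) :=
  isCompact_iff_compactSpace.mp (isCompact_relNormOneInfUnits_cm L)

/-! ### Weights: the place characters `U(1)_∞ → U(1)`, `y ↦ ι_w(y_w)` -/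

/-- `‖ι_w(y_w)‖ = 1` on the archimedean torus (`ι_w` = the tree's `InfiniteAdeleRing.infLocalUnits`).
[folklore] -/
theorem norm_infLocalUnits_eq_one {y : (InfiniteAdeleRing L)ˣ}
    (hy : y ∈ relNormOneInfUnits (maximalRealSubfield L) L) (w : InfinitePlace L) :
    ‖(InfiniteAdeleRing.infLocalUnits L w y : ℂ)‖ = 1 := by
  rw [InfiniteAdeleRing.coe_infLocalUnits,
    (Completion.isometry_extensionEmbedding w).norm_map_of_map_zero (map_zero _),
    norm_apply_eq_one_of_mem_relNormOneInfUnits L hy w]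

/-- **The weight character at the place `w`**: `U(W)(L⁺ ⊗ ℝ) → U(1)`, `y ↦ ι_w(y_w)`. [folklore] -/
def archPlaceChar (w : InfinitePlace L) : relNormOneInfUnits (maximalRealSubfield L) L →* Circle where
  toFun y := ⟨(InfiniteAdeleRing.infLocalUnits L w (y : (InfiniteAdeleRing L)ˣ) : ℂ),
    mem_sphere_zero_iff_norm.mpr (norm_infLocalUnits_eq_one L y.2 w)⟩
  map_one' := Circle.ext (by simp)
  map_mul' y z := Circle.ext (by simp)

/-- Values of the weight character. [folklore] -/
@[simp] theorem coe_archPlaceChar (w : InfinitePlace L) (y : relNormOneInfUnits (maximalRealSubfield L) L) :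
    ((archPlaceChar L w y : Circle) : ℂ) =
      Completion.extensionEmbedding w (((y : (InfiniteAdeleRing L)ˣ) : InfiniteAdeleRing L) w) := rfl

/-- The weight characters are continuous. [folklore] -/
theorem continuous_archPlaceChar (w : InfinitePlace L) : Continuous (archPlaceChar L w) :=
  Continuous.subtype_mk (Units.continuous_val.comp
    ((InfiniteAdeleRing.continuous_infLocalUnits L w).comp continuous_subtype_val)) _

/-- The joint weight map `U(W)(L⁺ ⊗ ℝ) → ∏_w U(1)`. [folklore] -/
def archPlaceChars : relNormOneInfUnits (maximalRealSubfield L) L →* (InfinitePlace L → Circle) :=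
  MonoidHom.pi fun w => archPlaceChar L w

/-- Components of the joint weight map. [folklore] -/
@[simp] theorem archPlaceChars_apply (y : relNormOneInfUnits (maximalRealSubfield L) L)
    (w : InfinitePlace L) : archPlaceChars L y w = archPlaceChar L w y := rfl

/-- The joint weight map is continuous. [folklore] -/
theorem continuous_archPlaceChars : Continuous (archPlaceChars L) :=
  continuous_pi fun w => continuous_archPlaceChar L w

/-- **`U(W)(L⁺ ⊗ ℝ) ↪ ∏_w U(1)`**: an element of the archimedean torus is determined by its weight
characters. [folklore] -/
theorem archPlaceChars_injective : Function.Injective (archPlaceChars L) := by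
  intro y z h
  apply Subtype.ext
  apply Units.ext
  funext w
  have hw := congrArg (fun f : InfinitePlace L → Circle => ((f w : Circle) : ℂ)) h
  simp only [archPlaceChars_apply, coe_archPlaceChar] at hw
  exact (Completion.isometry_extensionEmbedding w).injective hw

/-- The image of the archimedean torus in `∏_w U(1)` is compact. [folklore] -/
theorem isCompact_range_archPlaceChars : IsCompact (Set.range (archPlaceChars L)) :=
  isCompact_range (continuous_archPlaceChars L)

end CM

end Literature.NumberTheory.Automorphic

end
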